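import Literature.MathematicalPhysics.QuantumFieldTheory.Balaban1983to89.B9Eq349ConjugatedDPChain
import Literature.MathematicalPhysics.QuantumFieldTheory.Balaban1983to89.B9Eq319BumpSectionTorus

/-!
# `Balaban1983to89.B9Eq349ConjugatedDPChainSection` — T. Bałaban, *Propagators for lattice gauge theories in a background field*, Commun. Math.
# Phys. **99** (1985) 389–434 [Balaban1985BackgroundPropagators] (3.49) p. 399 with (3.19) p. 393, (3.24)–(3.25) p. 394, (3.35) p. 396: **THE SECTION
# LETTERS OF THE CONJUGATED `D P(U)` BOUND DISCHARGED — `Q̃′Ψ = 1` and `C_Ψ` of `B9Eq349ConjugatedDPChain.norm_conjDP_one_sub_RofU_le` from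
# ne9-leaf-05's bump section on the torus (`B9Eq319BumpSectionTorus.exists_bumpSection_torus_adTransportW`), read on the weighted carriers at `−κ̄`:
# `C_Ψ := √d·‖η⁻¹‖(M_φM_φ′)³(27∕4)^d(4∕L + 2(d−1)(L−1)δ)e^{‖κ‖ω}`** — route R2′ STEP B8′ S-P5(b), the porter's plug (part 3 of the composition)

statement-level skeleton of published theorems with citation tags; proofs where landed; nothing here is a claim about the Yang–Mills mass gap

CITATION HEADER (lean-in-tree rule).  Audit cell `pub-balaban`, sub-cell `t4`, BINDER row NE9; filed by NE9 formalisation-swarm leaf prover 06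
(`b2b-balaban-t4-ne9-formalise-leaf-06`, gen 66) as THE PLUG of its composition `B9Eq349ConjugatedDPChain` (parts 0∕1∕2: `B9Eq311PointwiseMultipliers`,
`B9Eq349ConjugatedDPChainLetters`, `B9Eq349ConjugatedDPChain`) with ne9-leaf-05 gen 73's (A) `B9Eq319BumpSectionTorus` (their word W-2, journal
2026-08-23: «THE PLUG `B9Eq349ConjugatedDPChainSection` IS YOURS — GO in advance»; CREDIT: the section, its profile and every constant below are theirs and
t4-ne9-idea-1's kernels 5∕6∕8; this file only reads their `ℓ²` statement on the `c₀`∕`c₁`-weighted carriers).  Source READ in the held text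
[Balaban1985BackgroundPropagators]: p. 393 (3.19) *«Q′ … onto»*, p. 394 (3.24)–(3.25), p. 396 (3.35), p. 399 (3.49) — as quoted in part 2's header.
A right inverse of `Q′(U)` is NOT print's road (random-walk expansion); NOTHING of print's estimate is asserted.

WHAT IS PROVED (sorry-free; proof lane — no `def`; the section `Ψ` is an anonymous `→ₗ[ℂ]` term INSIDE the proof; [folklore] bookkeeping BY NAME).
* `equiv_adjoint_S`, `equiv_adjoint_SBinv` (the adjoint multipliers act as `e^{κ̄χ}`, `e^{−κ̄χ(b₋)}` — part 0's `equiv_adjoint_of_pointwise` specialised).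
* **`norm_conjDP_one_sub_RofU_le_section`** — part 2's END with `hQPs`∕`hL` DISCHARGED: for `1 ≤ d`, `3 ≤ L`, `2 ≤ m_i`, plaquettes `‖U(∂p) − 1‖ ≤ δ` and a
  cut-off `χ` of block oscillation `≤ ω`, the conjugated `DP(U)` bound holds with `C_Ψ := √d·‖η⁻¹‖(M_φM_φ′)³(27∕4)^d(4∕L + 2(d−1)(L−1)δ)e^{‖κ‖ω}`.
  STILL DISPLAYED: `γ`, `κ₁`, `M`, `β`, the windows (named suppliers in part 2's header), and NOW `δ`, `ω`.
HONEST SCOPE.  Composition only; no number evaluated (at the diagonal `Lη = 1`, `δ ≤ Kη²` the constant is `η`-free — words, the arithmetic is the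
consumer's); ONE sub-step of ONE route step, NOT NE9 (cell pub-balaban: NE9 NOT PRINTED ∕ NOT PROVED; «NE9 ⇐ the named binders»; spine PROVED 0∕9; rung
(B)+1 on a finite T⁴ — NOT infinite volume, NOT mass gap, NOT Clay; HONEST DEPENDENCY: continuum YM on T⁴ ⇐ BetaPertH ∧ nine spine estimates (0/9 proved);
BetaPertH ⇐ (D1) ∧ (D4) ∧ CAP+tail; G-an2-4 gates asym, D1 and NE2/3/4).  NEW file; nothing modified.  Net new unproved facts: 0.
-/

noncomputable section

set_option autoImplicit false

open scoped InnerProductSpace ComplexConjugate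

namespace Literature.MathematicalPhysics.QuantumFieldTheory.Balaban1983to89.B9Eq349ConjugatedDPChainSection

open B4Sect5Torus (TSite)
open B9SectCLatticeCarrier (Bond bpos btgt)
open B9Eq311L2Pairing (WL2)
open B9Eq319QprimeTorus (fineP centre blockCoord QprimeLin)
open B11Eq103H1Complex (SiteL2K BondL2K covDerivL2K equiv_covDerivL2K)
open B7Prop1Explicit (U1)
open B9Eq33CovDerivVector (covDeriv)
open B9Eq310HessianOperator (adTransportW)
open B9Eq310DeltaPrime (plaqHolU)
open B9Eq326OperatorAssembly (QprimeW RofU)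
open B9Eq3119DeltaPiCarrier (laplacePrimeA GpOfU)
open B9Eq328GaugeAction (AdW)
open B7Eq44TorusAxialGaugeLocal (axialGaugeTAt)
open B9Eq311PointwiseMultipliers (equiv_adjoint_of_pointwise)
open B9Eq349ConjugatedDPChain (norm_conjDP_one_sub_RofU_le)
open B9Eq319BumpSectionTorus (exists_bumpSection_torus_adTransportW)

variable {d : ℕ} {L : ℕ} [NeZero L] {m : Fin d → ℕ} [∀ i, NeZero (fineP L m i)] {𝔸 : Type*} [NormedRing 𝔸] [NormedAlgebra ℂ 𝔸] [NormOneClass 𝔸]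
  {W : Type*} [NormedAddCommGroup W] [InnerProductSpace ℂ W] [FiniteDimensional ℂ W] {φ : W ≃ₗ[ℂ] 𝔸} {Mφ Mφ' : ℝ}
  (hφ : ∀ w, ‖φ w‖ ≤ Mφ * ‖w‖) (hφ' : ∀ X, ‖φ.symm X‖ ≤ Mφ' * ‖X‖) (hMφ : 0 ≤ Mφ) (hMφ' : 0 ≤ Mφ')
  {c₀ : ℝ} [Fact (0 < c₀)] {η : ℝ} (hη : 0 < η) {U : Bond d (fineP L m) → 𝔸ˣ} (hU : ∀ b, U b ∈ U1 𝔸) {εU : ℝ} (hεU : 0 ≤ εU)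
  (hUε : ∀ b, ‖(U b : 𝔸) - 1‖ ≤ εU) {c₁ : ℝ} [Fact (0 < c₁)] (hc : c₁ = (L : ℝ) ^ d * c₀) {a' : ℝ} (ha' : 0 ≤ a')
  (hRS : ∀ (b : Bond d (fineP L m)) (v u : W), ⟪adTransportW φ U b v, u⟫_ℂ = ⟪v, adTransportW φ (fun b => (U b)⁻¹) b u⟫_ℂ)
  (hpos' : ∀ x : SiteL2K ℂ d (fineP L m) c₀ W, x ≠ 0 → 0 < RCLike.re ⟪x, laplacePrimeA L m φ η U a' (c₁ := c₁) x⟫_ℂ)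
  {κ : ℂ} {ℓ ℓ' : ℝ} (hℓ : 0 ≤ ℓ) (hℓ' : 0 ≤ ℓ') {χ : TSite d (fineP L m) → ℝ} {χ' : TSite d m → ℝ}
  (hχ : ∀ b : Bond d (fineP L m), |χ (bpos b) - χ (btgt b)| ≤ ℓ * η)
  (hχ' : ∀ (y : TSite d m), ∀ x ∈ B9Eq319QprimeTorus.blockOf L m y, |χ' y - χ x| ≤ ℓ') (hwin : ‖κ‖ * ℓ * η ≤ 1) (hwin' : ‖κ‖ * ℓ' ≤ 1)
  {S Sinv : SiteL2K ℂ d (fineP L m) c₀ W →ₗ[ℂ] SiteL2K ℂ d (fineP L m) c₀ W}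
  (hS : ∀ (f : SiteL2K ℂ d (fineP L m) c₀ W) (x : TSite d (fineP L m)),
    WL2.equiv ℂ (fun _ : TSite d (fineP L m) => c₀) W (S f) x = Complex.exp (κ * (χ x : ℂ)) • WL2.equiv ℂ (fun _ : TSite d (fineP L m) => c₀) W f x)
  (hSinv : ∀ (f : SiteL2K ℂ d (fineP L m) c₀ W) (x : TSite d (fineP L m)),
    WL2.equiv ℂ (fun _ : TSite d (fineP L m) => c₀) W (Sinv f) x =
      Complex.exp (-(κ * (χ x : ℂ))) • WL2.equiv ℂ (fun _ : TSite d (fineP L m) => c₀) W f x)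
  {SB SBinv : BondL2K ℂ d (fineP L m) c₀ W →ₗ[ℂ] BondL2K ℂ d (fineP L m) c₀ W}
  (hSB : ∀ (g : BondL2K ℂ d (fineP L m) c₀ W) (b : Bond d (fineP L m)),
    WL2.equiv ℂ (fun _ : Bond d (fineP L m) => c₀) W (SB g) b = Complex.exp (κ * (χ (bpos b) : ℂ)) • WL2.equiv ℂ (fun _ : Bond d (fineP L m) => c₀) W g b)
  (hSBinv : ∀ (g : BondL2K ℂ d (fineP L m) c₀ W) (b : Bond d (fineP L m)),
    WL2.equiv ℂ (fun _ : Bond d (fineP L m) => c₀) W (SBinv g) b =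
      Complex.exp (-(κ * (χ (bpos b) : ℂ))) • WL2.equiv ℂ (fun _ : Bond d (fineP L m) => c₀) W g b)
  {SG SGinv : SiteL2K ℂ d m c₁ W →ₗ[ℂ] SiteL2K ℂ d m c₁ W}
  (hSG : ∀ (g : SiteL2K ℂ d m c₁ W) (y : TSite d m),
    WL2.equiv ℂ (fun _ : TSite d m => c₁) W (SG g) y = Complex.exp (κ * (χ' y : ℂ)) • WL2.equiv ℂ (fun _ : TSite d m => c₁) W g y)
  (hSGinv : ∀ (g : SiteL2K ℂ d m c₁ W) (y : TSite d m),
    WL2.equiv ℂ (fun _ : TSite d m => c₁) W (SGinv g) y = Complex.exp (-(κ * (χ' y : ℂ))) • WL2.equiv ℂ (fun _ : TSite d m => c₁) W g y)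

omit [NeZero L] [∀ i, NeZero (fineP L m i)] [NormOneClass 𝔸] in
include hS in
/-- `S†` acts as `e^{κ̄χ}` (`= e^{−(−κ̄)χ}`). [folklore] [cite: Balaban1985BackgroundPropagators, (3.11) p.392, (3.49) p.399] -/
theorem equiv_adjoint_S (f : SiteL2K ℂ d (fineP L m) c₀ W) (x : TSite d (fineP L m)) :
    WL2.equiv ℂ (fun _ : TSite d (fineP L m) => c₀) W (LinearMap.adjoint S f) x =
      Complex.exp (-(-conj κ * (χ x : ℂ))) • WL2.equiv ℂ (fun _ : TSite d (fineP L m) => c₀) W f x := by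
  rw [equiv_adjoint_of_pointwise S _ hS, ← Complex.exp_conj, map_mul, Complex.conj_ofReal, neg_mul, neg_neg]

omit [NeZero L] [∀ i, NeZero (fineP L m i)] [NormOneClass 𝔸] in
include hSBinv in
/-- `(S_B⁻¹)†` acts as `e^{−κ̄χ(b₋)}` (`= e^{(−κ̄)χ(b₋)}`). [folklore] [cite: Balaban1985BackgroundPropagators, (3.11) p.392, (3.49) p.399] -/
theorem equiv_adjoint_SBinv (g : BondL2K ℂ d (fineP L m) c₀ W) (b : Bond d (fineP L m)) :
    WL2.equiv ℂ (fun _ : Bond d (fineP L m) => c₀) W (LinearMap.adjoint SBinv g) b =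
      Complex.exp (-conj κ * (χ (bpos b) : ℂ)) • WL2.equiv ℂ (fun _ : Bond d (fineP L m) => c₀) W g b := by
  rw [equiv_adjoint_of_pointwise SBinv _ hSBinv, ← Complex.exp_conj, map_neg, map_mul, Complex.conj_ofReal, neg_mul]

include hφ hφ' hMφ hMφ' hη hU hεU hUε hc ha' hRS hℓ hℓ' hχ hχ' hwin hwin' hS hSinv hSB hSBinv hSG hSGinv in
/-- **THE CONJUGATED `D P(U)` BOUND WITH THE SECTION DISCHARGED**: part 2's `norm_conjDP_one_sub_RofU_le` with `Ψ` := ne9-leaf-05's bump section read on the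
weighted carriers (`Ψg(x) = θ(x)·R(A_{y(x)}(x))⁻¹ g(y(x))`), `Q̃′Ψ = 1` from their first conjunct, `C_Ψ` from their `ℓ²` bound at the parameter `−κ̄`
(`(S_B⁻¹)†`, `S†` act as `e^{−κ̄χ(b₋)}`, `e^{κ̄χ}`), the weights `c₀` cancelling. [cite: Balaban1985BackgroundPropagators, (3.49) p.399, (3.19) p.393, (3.35) p.396, (3.24)–(3.25) p.394] -/
theorem norm_conjDP_one_sub_RofU_le_section {γ κ₁ M β : ℝ} (hγ : 0 < γ) (hγ1 : γ ≤ 1) (hκ₁ : 0 < κ₁) (hM : 0 ≤ M) (hβ : 0 ≤ β) (hβ1 : β ≤ 1)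
    (coercive : ∀ f : SiteL2K ℂ d (fineP L m) c₀ W, γ * ‖f‖ ^ 2 ≤ ‖(covDerivL2K ℂ c₀ ((η : ℂ))⁻¹ (adTransportW φ U)) f‖ ^ 2 +
      a' * ‖((WL2.linearEquiv ℂ ℂ (fun _ : TSite d m => c₁)).symm.toLinearMap ∘ₗ QprimeW L m φ U (c₀ := c₀)) f‖ ^ 2)
    (hκ : ∀ ψ : SiteL2K ℂ d m c₁ W, κ₁ * ‖ψ‖ ^ 2 ≤ RCLike.re ⟪ψ,
      (((WL2.linearEquiv ℂ ℂ (fun _ : TSite d m => c₁)).symm.toLinearMap ∘ₗ QprimeW L m φ U (c₀ := c₀)) ∘ₗ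
        GpOfU L m φ η U a' (c₁ := c₁) hpos' ∘ₗ GpOfU L m φ η U a' (c₁ := c₁) hpos' ∘ₗ
        LinearMap.adjoint ((WL2.linearEquiv ℂ ℂ (fun _ : TSite d m => c₁)).symm.toLinearMap ∘ₗ QprimeW L m φ U (c₀ := c₀))) ψ⟫_ℂ)
    (hMQ : ∀ s : SiteL2K ℂ d (fineP L m) c₀ W, ‖((WL2.linearEquiv ℂ ℂ (fun _ : TSite d m => c₁)).symm.toLinearMap ∘ₗ QprimeW L m φ U (c₀ := c₀)) s‖ ≤ M * ‖s‖)
    (hβD : 2 * ‖κ‖ * ℓ * (Mφ * Mφ') * Real.sqrt d ≤ β) (hβQ : 2 * ‖κ‖ * ℓ' * (1 + 2 * Mφ * Mφ' * εU) ^ (d * (L - 1)) ≤ β)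
    (small : 3 * (1 + a') * β ^ 2 ≤ γ / 4) (hwinκ : 12 * (β * (4 / γ + M * ((4 / γ) ^ 2 * (3 + a' * (2 * M + 1))))) ≤ Real.sqrt κ₁)
    (hd : 1 ≤ d) (hL : 3 ≤ L) (hm : ∀ i, 2 ≤ m i) {δ ω : ℝ} (hδ0 : 0 ≤ δ) (hδ : ∀ p : B9SectCLatticeCarrier.Plaq d (fineP L m), ‖(plaqHolU U p : 𝔸) - 1‖ ≤ δ)
    (hω : ∀ (b : Bond d (fineP L m)) (x : TSite d (fineP L m)), blockCoord L m x = blockCoord L m (bpos b) → |χ (bpos b) - χ x| ≤ ω)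
    (x : SiteL2K ℂ d (fineP L m) c₀ W) :
    ‖(SB ∘ₗ (covDerivL2K ℂ c₀ ((η : ℂ))⁻¹ (adTransportW φ U)) ∘ₗ Sinv) (S (Sinv x - RofU L m φ η U (c₀ := c₀) (Sinv x)))‖ ≤
      2 * (Real.sqrt d * (‖((η : ℂ))⁻¹‖ * (Mφ * Mφ') ^ 3 * (((27 : ℝ) / 4) ^ d * (4 / (L : ℝ) + 2 * ((((d : ℝ) - 1) * ((L : ℝ) - 1)) * δ))) *
          Real.exp (‖κ‖ * ω)) + 3 * β +
        Real.sqrt (a' * (M + β) ^ 2 + Real.sqrt d * (‖((η : ℂ))⁻¹‖ * (Mφ * Mφ') ^ 3 * (((27 : ℝ) / 4) ^ d *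
          (4 / (L : ℝ) + 2 * ((((d : ℝ) - 1) * ((L : ℝ) - 1)) * δ))) * Real.exp (‖κ‖ * ω)) * β + (β ^ 2 + a' * (2 * M * β + β ^ 2)))) * ‖x‖ := by
  -- the section data of ne9-leaf-05's (A), in the chain's fibre dress
  obtain ⟨θ, hQ, hC⟩ := exists_bumpSection_torus_adTransportW L m hU φ hφ hφ' hMφ hMφ'
    (fun y x => AdW φ (axialGaugeTAt (fineP L m) U (centre L m y) x)⁻¹) (fun _ _ _ => rfl) hd hL hm hδ0 hδ
  -- `Ψ` as a linear map between the weighted carriers (an anonymous term; nothing is defined)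
  let Ps : SiteL2K ℂ d m c₁ W →ₗ[ℂ] SiteL2K ℂ d (fineP L m) c₀ W :=
    { toFun := fun g => (WL2.equiv ℂ (fun _ : TSite d (fineP L m) => c₀) W).symm fun x =>
        (θ x : ℂ) • AdW φ (axialGaugeTAt (fineP L m) U (centre L m (blockCoord L m x)) x)⁻¹ (WL2.equiv ℂ (fun _ : TSite d m => c₁) W g (blockCoord L m x))
      map_add' := fun g g' => (WL2.equiv ℂ (fun _ : TSite d (fineP L m) => c₀) W).injective (funext fun x => by
        simp only [WL2.equiv_add, Equiv.apply_symm_apply, Pi.add_apply, map_add, smul_add])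
      map_smul' := fun c g => (WL2.equiv ℂ (fun _ : TSite d (fineP L m) => c₀) W).injective (funext fun x => by
        simp only [WL2.equiv_smul, Equiv.apply_symm_apply, Pi.smul_apply, map_smul, RingHom.id_apply, smul_comm (θ x : ℂ) c]) }
  have hPs : ∀ (g : SiteL2K ℂ d m c₁ W) (x : TSite d (fineP L m)), WL2.equiv ℂ (fun _ : TSite d (fineP L m) => c₀) W (Ps g) x =
      (θ x : ℂ) • AdW φ (axialGaugeTAt (fineP L m) U (centre L m (blockCoord L m x)) x)⁻¹ (WL2.equiv ℂ (fun _ : TSite d m => c₁) W g (blockCoord L m x)) :=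
    fun _ _ => rfl
  -- `Q̃′Ψ = 1`
  have hQPs : ∀ g, ((WL2.linearEquiv ℂ ℂ (fun _ : TSite d m => c₁)).symm.toLinearMap ∘ₗ QprimeW L m φ U (c₀ := c₀)) (Ps g) = g := by
    intro g
    apply (WL2.equiv ℂ (fun _ : TSite d m => c₁) W).injective
    funext y
    exact hQ (WL2.equiv ℂ (fun _ : TSite d m => c₁) W g) y
  -- `C_Ψ` at `−κ̄`
  set CΨ : ℝ := Real.sqrt d * (‖((η : ℂ))⁻¹‖ * (Mφ * Mφ') ^ 3 * (((27 : ℝ) / 4) ^ d * (4 / (L : ℝ) + 2 * ((((d : ℝ) - 1) * ((L : ℝ) - 1)) * δ))) *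
    Real.exp (‖κ‖ * ω)) with hCΨ_def
  have hCΨ0 : 0 ≤ CΨ := by
    have hL1 : (1 : ℝ) ≤ L := by exact_mod_cast (show 1 ≤ L by omega)
    have : 0 ≤ (((d : ℝ) - 1) * ((L : ℝ) - 1)) * δ :=
      mul_nonneg (mul_nonneg (by rw [sub_nonneg]; exact_mod_cast hd) (by linarith)) hδ0
    positivity
  have hL' : ∀ u : SiteL2K ℂ d (fineP L m) c₀ W, ‖LinearMap.adjoint SBinv ((covDerivL2K ℂ c₀ ((η : ℂ))⁻¹ (adTransportW φ U))
      (Ps (((WL2.linearEquiv ℂ ℂ (fun _ : TSite d m => c₁)).symm.toLinearMap ∘ₗ QprimeW L m φ U (c₀ := c₀)) (LinearMap.adjoint S u))))‖ ≤ CΨ * ‖u‖ := by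
    intro u
    have hc₀ : 0 < c₀ := Fact.out
    -- the underlying site and bond functions
    have hSu : WL2.equiv ℂ (fun _ : TSite d (fineP L m) => c₀) W (LinearMap.adjoint S u) =
        fun z => Complex.exp (-(-conj κ * (χ z : ℂ))) • WL2.equiv ℂ (fun _ : TSite d (fineP L m) => c₀) W u z :=
      funext (equiv_adjoint_S hS u)
    have hq : ∀ y, WL2.equiv ℂ (fun _ : TSite d m => c₁) W
        (((WL2.linearEquiv ℂ ℂ (fun _ : TSite d m => c₁)).symm.toLinearMap ∘ₗ QprimeW L m φ U (c₀ := c₀)) (LinearMap.adjoint S u)) y =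
        QprimeLin L m (adTransportW φ U) (fun z => Complex.exp (-(-conj κ * (χ z : ℂ))) • WL2.equiv ℂ (fun _ : TSite d (fineP L m) => c₀) W u z) y := by
      intro y
      rw [← hSu]
      rfl
    have hfun : ∀ b, WL2.equiv ℂ (fun _ : Bond d (fineP L m) => c₀) W (LinearMap.adjoint SBinv ((covDerivL2K ℂ c₀ ((η : ℂ))⁻¹ (adTransportW φ U))
        (Ps (((WL2.linearEquiv ℂ ℂ (fun _ : TSite d m => c₁)).symm.toLinearMap ∘ₗ QprimeW L m φ U (c₀ := c₀)) (LinearMap.adjoint S u))))) b =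
        Complex.exp (-conj κ * (χ (bpos b) : ℂ)) • covDeriv ((η : ℂ))⁻¹ (adTransportW φ U) (fun x => (θ x : ℂ) •
          AdW φ (axialGaugeTAt (fineP L m) U (centre L m (blockCoord L m x)) x)⁻¹
            (QprimeLin L m (adTransportW φ U) (fun z => Complex.exp (-(-conj κ * (χ z : ℂ))) • WL2.equiv ℂ (fun _ : TSite d (fineP L m) => c₀) W u z)
              (blockCoord L m x))) b := by
      intro b
      have hw : WL2.equiv ℂ (fun _ : TSite d (fineP L m) => c₀) W
          (Ps (((WL2.linearEquiv ℂ ℂ (fun _ : TSite d m => c₁)).symm.toLinearMap ∘ₗ QprimeW L m φ U (c₀ := c₀)) (LinearMap.adjoint S u))) =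
          fun x => (θ x : ℂ) • AdW φ (axialGaugeTAt (fineP L m) U (centre L m (blockCoord L m x)) x)⁻¹
            (QprimeLin L m (adTransportW φ U) (fun z => Complex.exp (-(-conj κ * (χ z : ℂ))) • WL2.equiv ℂ (fun _ : TSite d (fineP L m) => c₀) W u z)
              (blockCoord L m x)) := by
        funext x
        rw [hPs, hq]
      rw [equiv_adjoint_SBinv hSBinv, equiv_covDerivL2K, hw]
    -- abstract the bond vector, then read its weighted norm through `WL2.norm_sq`
    generalize hV : LinearMap.adjoint SBinv ((covDerivL2K ℂ c₀ ((η : ℂ))⁻¹ (adTransportW φ U))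
        (Ps (((WL2.linearEquiv ℂ ℂ (fun _ : TSite d m => c₁)).symm.toLinearMap ∘ₗ QprimeW L m φ U (c₀ := c₀)) (LinearMap.adjoint S u)))) = v at hfun ⊢
    have hsq : ‖v‖ ^ 2 ≤ (CΨ * ‖u‖) ^ 2 := by
      rw [WL2.norm_sq v, mul_pow, WL2.norm_sq u, ← Finset.mul_sum, ← Finset.mul_sum]
      simp only [hfun]
      have h := hC ((η : ℂ))⁻¹ (-conj κ) χ ω hω (WL2.equiv ℂ (fun _ : TSite d (fineP L m) => c₀) W u)
      rw [norm_neg, Complex.norm_conj] at h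
      have e : CΨ ^ 2 = d * ((‖((η : ℂ))⁻¹‖ * (Mφ * Mφ') ^ 3 * (((27 : ℝ) / 4) ^ d * (4 / (L : ℝ) + 2 * ((((d : ℝ) - 1) * ((L : ℝ) - 1)) * δ))) *
          Real.exp (‖κ‖ * ω)) ^ 2) := by
        rw [hCΨ_def, mul_pow, Real.sq_sqrt (Nat.cast_nonneg d)]
      rw [e]
      calc c₀ * (∑ b, ‖_‖ ^ 2) ≤ c₀ * _ := mul_le_mul_of_nonneg_left h hc₀.le
        _ = _ := by ring
    exact (pow_le_pow_iff_left₀ (norm_nonneg _) (mul_nonneg hCΨ0 (norm_nonneg _)) two_ne_zero).1 hsq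
  exact norm_conjDP_one_sub_RofU_le hφ hφ' hMφ hMφ' hη hU hεU hUε hc ha' hRS hpos' hℓ hℓ' hχ hχ' hwin hwin' hS hSinv hSB hSBinv hSG hSGinv hγ hγ1 hκ₁ hM
    hCΨ0 hβ hβ1 coercive hκ hMQ hβD hβQ small hwinκ hQPs hL' x

end Literature.MathematicalPhysics.QuantumFieldTheory.Balaban1983to89.B9Eq349ConjugatedDPChainSection

end
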